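import Mathlib
import HarnessLib
import Summits.AtomisticToContinuum.FouriersLaw.Theses.JunctionLocality
import Summits.AtomisticToContinuum.FouriersLaw.Theorems.JunctionLocalityDefs
import Summits.AtomisticToContinuum.FouriersLaw.Theorems.JunctionLocalityConductanceLowerBoundStubEscapeFloorAux2
import Summits.AtomisticToContinuum.FouriersLaw.Theorems.HonestZwanzigOpenChainGreenKuboKuboPairing

/-!
# Crux `ConductanceLowerBound` (stmt-AtomisticToContinuum-11749), line `kick-dipole-no-collapse` — helper 5:
# exponential decay of the kick-response kernel and the terminal value of the booked dipole (fixed `N`)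

Helper file for the fixed-`N` kick-dipole identities of the line (lead c1).  For the pinned anharmonic chain
`P = pinnedChain ω₂ lam β γ` (all parameters `> 0`), `T > 0` and `N ≥ 1` (equal bath temperatures, NO hypothesis of the
crux):

* `helper_kdKickKernelExpDecay` — **`|𝒥_N(s)| ≤ C_N e^{−c_N s}` for `s ≥ 0`, `𝒥_N ∈ L¹(0,∞)`, and
  `𝔇_N(t) → ∫₀^∞ 𝒥_N` as `t → ∞`**: the halved kernel `𝒥_N(s) = (γ/T²)⟨p_0² − T, κ_s J⟩_{μ_T}` (helper 1), the scaled
  Harris bound `|κ_s J(z)| ≤ K·C_J·e^{ϑH(z)}e^{−cs}` for the CENTRED nice current `J` (`μ_T(J) = 0`, CEHR (2.5) with the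
  limit identified as `μ_T`, `OddSectorIrreversibility.pinnedChain_harris_bound`) and `|p_0² − T|e^{ϑH} ∈ L¹(μ_T)`
  (`ϑ = 1/(4T)`).  So the booked dipole has a TERMINAL VALUE `𝔇_N(∞) = ∫₀^∞ 𝒥_N` at every fixed length — the object of
  the merged bet of the line (`θ·𝔇_N(t₀) ≤ ∫₀^∞ 𝒥_N` eventually in `N`);
* `helper_kdLeftEnergyRelaxation` — **`⟨p_0² − T, κ_t E_L⟩_{μ_T} → 0` as `t → ∞`** (`E_L = H − X/(N−1)`, `N ≥ 2`; Harris
  bound for the nice observable `E_L`, `∫ (p_0² − T) dμ_T = 0`), so that in the left reading of helper 3,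
  `𝔇_N(t) = (γ(N−1)/T²)(T² − ⟨k_0, κ_t E_L⟩ − γ∫₀ᵗ K_N)`, the terminal value is
  `𝔇_N(∞) = γ(N−1)(1 − (γ/T²)∫₀^∞ K_N)` — the normalisation of `BoundaryEscapeDeficit.ResponseIdentity`.
-/

noncomputable section

open MeasureTheory ProbabilityTheory Filter Topology Set
open scoped NNReal ENNReal BigOperators
open Literature.MathematicalPhysics.KineticTheory.HeatConduction
open Literature.Barriers.AtomisticToContinuum.OpenChain
open Summit.AtomisticToContinuum.FouriersLaw.Theorems.JunctionLocality
open Summit.AtomisticToContinuum.FouriersLaw.Theorems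

namespace Summit.AtomisticToContinuum.FouriersLaw.Cruxes.ConductanceLowerBound.KickDipoleNoCollapse

variable {N : ℕ}

/-- **Exponential decay of a centred equilibrium pairing against the contact kick.**  For the pinned chain
(all parameters `> 0`), `T > 0`, `N ≥ 1`, and a continuous `f` with `|f| ≤ C_f e^{H/(4T)}` and `μ_T(f) = 0`, there are
`C, c > 0` with `|∫ (p_0² − T)·(κ_s f) dμ_T| ≤ C e^{−cs}` for all `s ≥ 0` (scaled Harris bound + `|p_0² − T|e^{ϑH} ∈ L¹`). -/
theorem abs_kinExcess_pairing_le_exp {ω₂ lam β γ : ℝ} (hω : 0 < ω₂) (hl : 0 < lam) (hβ : 0 < β) (hγ : 0 < γ)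
    (hN : 0 < N) {T : ℝ} (hT : 0 < T) {f : PhaseSpace N → ℝ} (hf : Continuous f) {Cf : ℝ} (hCf : 0 ≤ Cf)
    (hfb : ∀ y, |f y| ≤ Cf * Real.exp (1 / (4 * T) * (pinnedChain ω₂ lam β γ).hamiltonian N y))
    (hf0 : ∫ y, f y ∂((pinnedChain ω₂ lam β γ).gibbsMeasure N T) = 0) :
    ∃ C c : ℝ, 0 < c ∧ ∀ s : ℝ, 0 ≤ s →
      |∫ z, (z.2 ⟨0, hN⟩ ^ 2 - T) * evolve (pinnedChain ω₂ lam β γ) N T f s z ∂((pinnedChain ω₂ lam β γ).gibbsMeasure N T)| ≤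
        C * Real.exp (-c * s) := by
  set P := pinnedChain ω₂ lam β γ with hP
  obtain ⟨hϑ0, h2ϑ⟩ := LightConeBondHeat.quarter_inv_temp_admissible hT
  have hϑ1 : 1 / (4 * T) < 1 / T := by linarith
  obtain ⟨K, c, hK, hc, hb⟩ := OddSectorIrreversibility.pinnedChain_harris_bound hω hl.le hβ hγ hN hT hϑ0 hϑ1
  have hkc : Continuous (fun z : PhaseSpace N => z.2 ⟨0, hN⟩ ^ 2 - T) := by fun_prop
  have hkb : ∀ z : PhaseSpace N, |z.2 ⟨0, hN⟩ ^ 2 - T| ≤ (2 / (1 / (4 * T)) + T) * Real.exp (1 / (4 * T) * P.hamiltonian N z) :=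
    fun z => SubdiffusiveBondHeat.abs_sq_momentum_sub_le_exp hω hl.le hβ.le hϑ0 hT.le z ⟨0, hN⟩
  refine ⟨(2 / (1 / (4 * T)) + T) * (K * Cf) * ∫ z, Real.exp (2 * (1 / (4 * T)) * P.hamiltonian N z) ∂(P.gibbsMeasure N T),
    c, hc, fun s hs => ?_⟩
  -- pointwise decay of `κ_s f`
  have hdec : ∀ z, |evolve P N T f s z| ≤ K * Cf * Real.exp (-c * s) * Real.exp (1 / (4 * T) * P.hamiltonian N z) := by
    intro z
    have h := hb z s.toNNReal f hf Cf hCf hfb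
    rw [hf0, sub_zero, Real.coe_toNNReal _ hs] at h
    calc |evolve P N T f s z| ≤ K * Cf * Real.exp (1 / (4 * T) * P.hamiltonian N z) * Real.exp (-c * s) := h
      _ = _ := by ring
  have hWm : StronglyMeasurable (evolve P N T f s) := hf.stronglyMeasurable.integral_kernel (κ := P.transitionKernel N T T s.toNNReal)
  obtain ⟨-, hle⟩ := OpenChainGreenKubo.integrable_nice_mul_of_abs_le_exp hω hl.le hβ hT h2ϑ hkc hWm hkb hdec
  calc _ ≤ (2 / (1 / (4 * T)) + T) * (K * Cf * Real.exp (-c * s)) *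
        ∫ z, Real.exp (2 * (1 / (4 * T)) * P.hamiltonian N z) ∂(P.gibbsMeasure N T) := hle
    _ = _ := by ring

/-- **helper — EXPONENTIAL DECAY OF THE KICK-RESPONSE KERNEL AND THE TERMINAL VALUE OF THE BOOKED DIPOLE** (fixed
`N ≥ 1`, equal bath temperatures; no hypothesis of the crux).  For the pinned anharmonic chain (all parameters `> 0`) and
`T > 0`: there are `C` and `c > 0` with `|kickKernel P N T s| ≤ C e^{−cs}` for all `s ≥ 0`; the kernel is integrable on
`(0, ∞)`; and `bookedDipole P N T t → ∫_{(0,∞)} kickKernel P N T` as `t → ∞`.  (Halved kernel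
`𝒥_N(s) = (γ/T²)⟨p_0² − T, κ_s J⟩_{μ_T}` of helper 1, scaled Harris bound for the centred nice current `J`, measurability of
`𝒥_N` from helper 2, `intervalIntegral_tendsto_integral_Ioi`.) -/
theorem helper_kdKickKernelExpDecay : ∀ ω₂ lam β γ : ℝ, 0 < ω₂ → 0 < lam → 0 < β → 0 < γ → ∀ T : ℝ, 0 < T → ∀ N : ℕ, 0 < N → (∃ C c : ℝ, 0 < c ∧ ∀ s : ℝ, 0 ≤ s → |kickKernel (pinnedChain ω₂ lam β γ) N T s| ≤ C * Real.exp (-c * s)) ∧ IntegrableOn (kickKernel (pinnedChain ω₂ lam β γ) N T) (Ioi 0) ∧ Tendsto (bookedDipole (pinnedChain ω₂ lam β γ) N T) atTop (𝓝 (∫ s in Ioi (0 : ℝ), kickKernel (pinnedChain ω₂ lam β γ) N T s)) := by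
  intro ω₂ lam β γ hω hl hβ hγ T hT N hN
  set P := pinnedChain ω₂ lam β γ with hP
  obtain ⟨hϑ0, -⟩ := LightConeBondHeat.quarter_inv_temp_admissible hT
  have hJc : Continuous (totalCurrentObs P N) := OddSectorIrreversibility.continuous_totalBondCurrent ω₂ lam β γ N
  have hCJ : (0 : ℝ) ≤ N * (N * ((3 + β) / 2) * (2 * Real.exp (1 / (4 * T)) / (1 / (4 * T)) ^ 2)) := by
    have := hβ.le; positivity
  have hJb : ∀ y : PhaseSpace N, |totalCurrentObs P N y| ≤
      N * (N * ((3 + β) / 2) * (2 * Real.exp (1 / (4 * T)) / (1 / (4 * T)) ^ 2)) * Real.exp (1 / (4 * T) * P.hamiltonian N y) :=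
    OddSectorIrreversibility.abs_totalBondCurrent_le_exp hω.le hl.le hβ.le γ N hϑ0
  have hJ0 : ∫ y, totalCurrentObs P N y ∂(P.gibbsMeasure N T) = 0 :=
    OddSectorIrreversibility.integral_totalBondCurrent_gibbsMeasure hω hl.le hβ.le γ N hT
  obtain ⟨C, c, hc, hdec⟩ := abs_kinExcess_pairing_le_exp hω hl hβ hγ hN hT hJc hCJ hJb hJ0
  have hhalf : ∀ s, kickKernel P N T s = γ / T ^ 2 * ∫ z, (z.2 ⟨0, hN⟩ ^ 2 - T) *
      evolve P N T (totalCurrentObs P N) s z ∂(P.gibbsMeasure N T) :=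
    fun s => helper_kdKickKernelHalving ω₂ lam β γ hω hl hβ hγ T hT N hN s
  have hbound : ∀ s : ℝ, 0 ≤ s → |kickKernel P N T s| ≤ |γ / T ^ 2| * C * Real.exp (-c * s) := by
    intro s hs
    rw [hhalf s, abs_mul, mul_assoc]
    exact mul_le_mul_of_nonneg_left (hdec s hs) (abs_nonneg _)
  obtain ⟨hmeas, -, -⟩ := helper_kdKickKernelBounded ω₂ lam β γ hω hl hβ hγ T hT N hN
  have hint : IntegrableOn (kickKernel P N T) (Ioi 0) := by
    refine Integrable.mono' ((exp_neg_integrableOn_Ioi 0 hc).const_mul (|γ / T ^ 2| * C)) hmeas.aestronglyMeasurable ?_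
    refine (ae_restrict_iff' measurableSet_Ioi).2 (Eventually.of_forall fun s hs => ?_)
    rw [Real.norm_eq_abs]
    calc |kickKernel P N T s| ≤ |γ / T ^ 2| * C * Real.exp (-c * s) := hbound s (le_of_lt hs)
      _ = _ := by ring
  refine ⟨⟨|γ / T ^ 2| * C, c, hc, hbound⟩, hint, ?_⟩
  have h := intervalIntegral_tendsto_integral_Ioi 0 hint tendsto_id
  refine h.congr fun t => ?_
  rw [bookedDipole_def]
  rfl

/-- **helper — RELAXATION OF THE LEFT-EXIT-WEIGHTED ENERGY AFTER THE CONTACT KICK** (fixed `N ≥ 2`): for the pinned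
anharmonic chain (all parameters `> 0`) and `T > 0`, `⟨p_0² − T, κ_t E_L⟩_{μ_T} → 0` as `t → ∞`, `E_L = H − X/(N−1)`
(`X = energyMoment`); indeed `|⟨p_0² − T, κ_t E_L⟩| ≤ C e^{−ct}` for `t ≥ 0` (Harris bound for the nice observable `E_L`
recentred by `μ_T(E_L)`, and `∫ (p_0² − T) dμ_T = 0`).  With the left reading of helper 3 this identifies the terminal value
`𝔇_N(∞) = γ(N−1)(1 − (γ/T²)∫₀^∞ ⟨p_0² − T, κ_s(p_0² − T)⟩_{μ_T} ds)`. -/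
theorem helper_kdLeftEnergyRelaxation : ∀ ω₂ lam β γ : ℝ, 0 < ω₂ → 0 < lam → 0 < β → 0 < γ → ∀ T : ℝ, 0 < T → ∀ (N : ℕ) (hN : 2 ≤ N), (∃ C c : ℝ, 0 < c ∧ ∀ t : ℝ, 0 ≤ t → |∫ z, (z.2 ⟨0, by omega⟩ ^ 2 - T) * evolve (pinnedChain ω₂ lam β γ) N T (fun y : PhaseSpace N => (pinnedChain ω₂ lam β γ).hamiltonian N y - energyMoment (pinnedChain ω₂ lam β γ) N y / ((N : ℝ) - 1)) t z ∂((pinnedChain ω₂ lam β γ).gibbsMeasure N T)| ≤ C * Real.exp (-c * t)) ∧ Tendsto (fun t : ℝ => ∫ z, (z.2 ⟨0, by omega⟩ ^ 2 - T) * evolve (pinnedChain ω₂ lam β γ) N T (fun y : PhaseSpace N => (pinnedChain ω₂ lam β γ).hamiltonian N y - energyMoment (pinnedChain ω₂ lam β γ) N y / ((N : ℝ) - 1)) t z ∂((pinnedChain ω₂ lam β γ).gibbsMeasure N T)) atTop (𝓝 0) := by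
  intro ω₂ lam β γ hω hl hβ hγ T hT N hN
  have hN0 : 0 < N := by omega
  set P := pinnedChain ω₂ lam β γ with hP
  haveI : IsProbabilityMeasure (P.gibbsMeasure N T) := pinnedChain_isProbabilityMeasure_gibbsMeasure hω hl.le hβ.le γ N hT
  obtain ⟨hϑ0, h2ϑ⟩ := LightConeBondHeat.quarter_inv_temp_admissible hT
  have hϑ1 : 1 / (4 * T) < 1 / T := by linarith
  -- `E_L` and its recentring `E_L - μ_T(E_L)`: continuous, nice, centred
  set E : PhaseSpace N → ℝ := fun y => P.hamiltonian N y - energyMoment P N y / ((N : ℝ) - 1) with hE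
  have hEc : Continuous E := by
    have h1 : Continuous (P.hamiltonian N) := pinnedChain_continuous_hamiltonian ω₂ lam β γ N
    have h2 : Continuous (energyMoment P N) :=
      (OddSectorIrreversibility.contDiff_energyMoment_of_contDiff P (N := N) (pinnedChain_contDiff_U ω₂ lam β γ (n := 0))
        (pinnedChain_contDiff_V ω₂ lam β γ (n := 0))).continuous
    exact h1.sub (h2.div_const _)
  have hEb : ∀ y, |E y| ≤ 1 / (1 / (4 * T)) * Real.exp (1 / (4 * T) * P.hamiltonian N y) := by
    intro y
    obtain ⟨h0, h1⟩ := OddSectorIrreversibility.pinnedChain_leftEnergy_nonneg_le hω.le hl.le hβ.le γ hN y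
    rw [hE]; dsimp only; rw [abs_of_nonneg h0]
    refine h1.trans ?_
    have hx : 1 / (4 * T) * P.hamiltonian N y + 1 ≤ Real.exp (1 / (4 * T) * P.hamiltonian N y) := Real.add_one_le_exp _
    rw [div_mul_eq_mul_div, one_mul, le_div_iff₀ hϑ0]
    nlinarith
  have hEI : Integrable E (P.gibbsMeasure N T) :=
    SubdiffusiveBondHeat.integrable_of_abs_le_exp (pinnedChain_integrable_exp_mul_hamiltonian_gibbsMeasure hω hl.le hβ.le γ N hT hϑ1) hEc hEb
  set m : ℝ := ∫ y, E y ∂(P.gibbsMeasure N T) with hm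
  set F : PhaseSpace N → ℝ := fun y => E y - m with hF
  have hFc : Continuous F := hEc.sub continuous_const
  have hH0 : ∀ y, 0 ≤ P.hamiltonian N y := fun y => pinnedChain_hamiltonian_nonneg hω.le hl.le hβ.le γ N y
  have hFb : ∀ y, |F y| ≤ (1 / (1 / (4 * T)) + |m|) * Real.exp (1 / (4 * T) * P.hamiltonian N y) := by
    intro y
    have h1 : 1 ≤ Real.exp (1 / (4 * T) * P.hamiltonian N y) := Real.one_le_exp (mul_nonneg hϑ0.le (hH0 y))
    calc |F y| ≤ |E y| + |m| := abs_sub _ _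
      _ ≤ 1 / (1 / (4 * T)) * Real.exp (1 / (4 * T) * P.hamiltonian N y) + |m| * Real.exp (1 / (4 * T) * P.hamiltonian N y) := by
          have := hEb y; nlinarith [abs_nonneg m]
      _ = _ := by ring
  have hF0 : ∫ y, F y ∂(P.gibbsMeasure N T) = 0 := by
    rw [hF]; dsimp only
    rw [integral_sub hEI (integrable_const m), integral_const]
    simp [hm]
  have hCF : 0 ≤ 1 / (1 / (4 * T)) + |m| := by positivity
  obtain ⟨C, c, hc, hdec⟩ := abs_kinExcess_pairing_le_exp hω hl hβ hγ hN0 hT hFc hCF hFb hF0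
  -- `⟨k_0, κ_t E⟩ = ⟨k_0, κ_t F⟩` (the constant `m` pairs to `m ∫ k_0 dμ_T = 0`)
  have hk0 : ∫ z, (z.2 ⟨0, hN0⟩ ^ 2 - T) ∂(P.gibbsMeasure N T) = 0 :=
    SubdiffusiveBondHeat.pinnedChain_integral_kinObs_gibbsMeasure hω hl.le hβ.le γ N hT ⟨0, hN0⟩
  obtain ⟨hkc, -, hkmul⟩ := kinExcess_facts hω hl hβ hγ hN0 hT ⟨0, hN0⟩
  have hkI : Integrable (fun z : PhaseSpace N => z.2 ⟨0, hN0⟩ ^ 2 - T) (P.gibbsMeasure N T) := by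
    obtain ⟨-, hk2, -⟩ := kinExcess_facts hω hl hβ hγ hN0 hT ⟨0, hN0⟩
    exact ((memLp_two_iff_integrable_sq hkc.aestronglyMeasurable).2 hk2).integrable one_le_two
  have heq : ∀ t : ℝ, 0 ≤ t → ∫ z, (z.2 ⟨0, hN0⟩ ^ 2 - T) * evolve P N T E t z ∂(P.gibbsMeasure N T) =
      ∫ z, (z.2 ⟨0, hN0⟩ ^ 2 - T) * evolve P N T F t z ∂(P.gibbsMeasure N T) := by
    intro t _
    haveI : IsMarkovKernel (P.transitionKernel N T T t.toNNReal) :=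
      pinnedChain_isMarkovKernel_transitionKernel hω hl.le hβ.le hγ.le N T T t.toNNReal
    have hEk : ∀ z, Integrable E (P.transitionKernel N T T t.toNNReal z) := fun z =>
      SubdiffusiveBondHeat.integrable_of_abs_le_exp
        (SubdiffusiveBondHeat.pinnedChain_integrable_exp_mul_hamiltonian_transitionKernel hω hl.le hT hβ.le hγ.le hN0 hϑ0 hϑ1 _ z) hEc hEb
    have hpt : ∀ z, evolve P N T F t z = evolve P N T E t z - m := by
      intro z
      unfold evolve
      rw [hF]; dsimp only
      rw [integral_sub (hEk z) (integrable_const m), integral_const]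
      simp
    have hFm : StronglyMeasurable (evolve P N T F t) := hFc.stronglyMeasurable.integral_kernel (κ := P.transitionKernel N T T t.toNNReal)
    obtain ⟨-, hPF2, -⟩ := SubdiffusiveBondHeat.pinnedChain_integral_sq_act_le hω hl.le hβ hγ hN0 hT hϑ0 h2ϑ hFc hFb t.toNNReal
    have hiF := hkmul _ hFm hPF2
    have he2 : ∀ z, (z.2 ⟨0, hN0⟩ ^ 2 - T) * evolve P N T E t z =
        (z.2 ⟨0, hN0⟩ ^ 2 - T) * evolve P N T F t z + m * (z.2 ⟨0, hN0⟩ ^ 2 - T) := by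
      intro z; rw [hpt z]; ring
    rw [integral_congr_ae (Eventually.of_forall he2), integral_add hiF (hkI.const_mul m), integral_const_mul, hk0]
    ring
  have hbound : ∀ t : ℝ, 0 ≤ t → |∫ z, (z.2 ⟨0, hN0⟩ ^ 2 - T) * evolve P N T E t z ∂(P.gibbsMeasure N T)| ≤ C * Real.exp (-c * t) := by
    intro t ht; rw [heq t ht]; exact hdec t ht
  refine ⟨⟨C, c, hc, hbound⟩, ?_⟩
  have hC0 : 0 ≤ C := by
    have h := hbound 0 le_rfl
    rw [mul_zero, Real.exp_zero, mul_one] at h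
    exact (abs_nonneg _).trans h
  have hlim : Tendsto (fun t : ℝ => C * Real.exp (-c * t)) atTop (𝓝 0) := by
    have h1 : Tendsto (fun t : ℝ => c * t) atTop atTop := tendsto_id.const_mul_atTop hc
    have h2 := (Real.tendsto_exp_neg_atTop_nhds_zero.comp h1).const_mul C
    rw [mul_zero] at h2
    refine h2.congr fun t => ?_
    simp [Function.comp, neg_mul]
  refine squeeze_zero_norm' ?_ hlim
  filter_upwards [eventually_ge_atTop (0 : ℝ)] with t ht
  rw [Real.norm_eq_abs]
  exact hbound t ht

end Summit.AtomisticToContinuum.FouriersLaw.Cruxes.ConductanceLowerBound.KickDipoleNoCollapse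

end
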